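import Summits.Ventures.YMGap.RobustBall.AxialPairGeometry
import Summits.Ventures.YMGap.RobustBall.AdjointWitness
import HarnessLib

/-!
# Venture YMGap, track ROBUST-BALL (tier 2) — the axial plaquette-pair term and its one-link witnesses

HONEST FRAMING. WHAT THIS IS: a venture file (cell `pub-ymgap`, track Y2 ROBUST-BALL, seat rb-p1), the
TERM LAYER of the infinite-range member `AxialPairWitness.lean` of the tier-2 ball: the normalised
fundamental plaquette observable `plaqObsN N p U = Re tr U_p / N ∈ [-1, 1]` (bounded by `1`,
`1/√N`-Lipschitz in each of its four links, constant in every other link, `= 1` at `U ≡ 1`) and the axial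
pair term `axialTerm N τ κ (p, a, n) U = τ κ^{n+1} (Re tr U_p/N)(Re tr U_{p+(n+1)e_a}/N)`: continuous,
carried by `axialCode (p, a, n)`, bounded by `|τ| κ^{n+1}`, with oscillation witness `2|τ|κ^{n+1}` and
Frobenius–Lipschitz witness `|τ|κ^{n+1}/√N · (𝟙[y ∈ p] + 𝟙[y ∈ partner])`. WHAT IT IS NOT: no measure,
no Gibbs state, no number; nothing about the continuum limit or the Clay problem.

References: one-link Lipschitz bound of the plaquette trace = the tree's `abs_plaquetteObs_sub_le_of_eq_off`
(`AdjointWitness.lean`, after Shen–Zhu–Zhu, CMP 400 (2023), §4).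
-/

noncomputable section

open MeasureTheory Filter Function Topology Real Finset
open Literature.Probability.LatticeModels
open Literature.Probability.LatticeModels.DobrushinMetric
open Literature.MathematicalPhysics.QuantumLattice
open Literature.MathematicalPhysics.QuantumFieldTheory hiding ZdEdge

namespace Summit.Ventures.YMGap.RobustBall

variable {d N : ℕ}

/-! ### The normalised plaquette observable `Re tr U_p / N` -/

section Obs

variable (N) in
/-- The normalised fundamental plaquette observable `Re tr U_p / N ∈ [-1, 1]`. -/
def plaqObsN (p : ZdPlaquette d) (U : LGConfig d (Matrix.specialUnitaryGroup (Fin N) ℂ)) : ℝ :=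
  plaquetteObs (fundamentalRep (Fin N)) p.1 p.2.1.1 p.2.1.2 U / N

/-- `|Re tr U_p / N| ≤ 1`. -/
theorem abs_plaqObsN_le_one (hN : 1 ≤ N) (p : ZdPlaquette d)
    (U : LGConfig d (Matrix.specialUnitaryGroup (Fin N) ℂ)) : |plaqObsN N p U| ≤ 1 :=
  abs_plaquetteObs_div_le_one hN p U

/-- Continuity of the normalised plaquette observable. -/
theorem continuous_plaqObsN (p : ZdPlaquette d) : Continuous (plaqObsN (d := d) N p) :=
  (continuous_plaquetteObs _ (continuous_fundamentalRep (Fin N)) _ _ _).div_const _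

/-- The normalised plaquette observable reads only the links of its plaquette. -/
theorem plaqObsN_congr {p : ZdPlaquette d} {U V : LGConfig d (Matrix.specialUnitaryGroup (Fin N) ℂ)}
    (h : ∀ e ∈ plaquetteEdges p, U e = V e) : plaqObsN N p U = plaqObsN N p V := by
  unfold plaqObsN
  rw [isCylinder_plaquetteObs (fundamentalRep (Fin N)) p (fun e he => h e (Finset.mem_coe.1 he))]

/-- **One-link Lipschitz bound**: if `U = V` off `y` then
`|Re tr U_p/N - Re tr V_p/N| ≤ 𝟙[y ∈ p] ‖U_y - V_y‖_F / √N`. -/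
theorem abs_plaqObsN_sub_le (hN : 1 ≤ N) (p : ZdPlaquette d) {y : ZdEdge d}
    {U V : LGConfig d (Matrix.specialUnitaryGroup (Fin N) ℂ)} (hUV : ∀ z, z ≠ y → U z = V z) :
    |plaqObsN N p U - plaqObsN N p V| ≤
      (if y ∈ plaquetteEdges p then 1 / Real.sqrt N else 0) * suFrobDist (U y) (V y) := by
  have hN0 : (0 : ℝ) < N := by exact_mod_cast hN
  have hsN : 0 < Real.sqrt N := Real.sqrt_pos.2 hN0
  by_cases hy : y ∈ plaquetteEdges p
  · rw [if_pos hy]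
    unfold plaqObsN
    rw [← sub_div, abs_div, abs_of_pos hN0, div_le_iff₀ hN0]
    calc |plaquetteObs (fundamentalRep (Fin N)) p.1 p.2.1.1 p.2.1.2 U -
          plaquetteObs (fundamentalRep (Fin N)) p.1 p.2.1.1 p.2.1.2 V|
        ≤ Real.sqrt N * suFrobDist (U y) (V y) := abs_plaquetteObs_sub_le_of_eq_off hy hUV
      _ = suFrobDist (U y) (V y) * ((N : ℝ) / Real.sqrt N) := by rw [Real.div_sqrt, mul_comm]
      _ = 1 / Real.sqrt N * suFrobDist (U y) (V y) * N := by
          rw [one_div, div_eq_mul_inv]; ring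
  · rw [if_neg hy, zero_mul]
    rw [plaqObsN_congr (fun e he => hUV e (fun h => hy (h ▸ he))), sub_self, abs_zero]

/-- At the trivial configuration `U ≡ 1` the normalised plaquette observable equals `1`. -/
theorem plaqObsN_one (hN : 1 ≤ N) (p : ZdPlaquette d) :
    plaqObsN N p (1 : LGConfig d (Matrix.specialUnitaryGroup (Fin N) ℂ)) = 1 := by
  have hN0 : (N : ℝ) ≠ 0 := by exact_mod_cast (Nat.one_le_iff_ne_zero.1 hN)
  unfold plaqObsN plaquetteObs plaquetteHolonomyZd
  simp only [Pi.one_apply, inv_one, mul_one, map_one, Matrix.trace_one, Fintype.card_fin]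
  rw [Complex.natCast_re, div_self hN0]

end Obs

/-! ### The axial pair term and its one-link witnesses -/

section Term

variable (N) in
/-- **The axial pair term** of index `i = (p, a, n)`:
`τ κ^{n+1} · (Re tr U_p / N) · (Re tr U_{p + (n+1) e_a} / N)`. -/
def axialTerm (τ κ : ℝ) (i : AxialIdx d) (U : LGConfig d (Matrix.specialUnitaryGroup (Fin N) ℂ)) : ℝ :=
  τ * κ ^ (i.2.2 + 1) * (plaqObsN N i.1 U * plaqObsN N (partner i) U)

variable {τ κ : ℝ}

/-- Continuity of the term. -/
theorem continuous_axialTerm (i : AxialIdx d) : Continuous (axialTerm (d := d) N τ κ i) :=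
  continuous_const.mul ((continuous_plaqObsN _).mul (continuous_plaqObsN _))

/-- The term reads only its carrier. -/
theorem dependsOn_axialTerm (i : AxialIdx d) :
    DependsOn (axialTerm (d := d) N τ κ i) (↑(axialCode i) : Set (ZdEdge d)) := by
  intro U V hUV
  unfold axialTerm
  rw [plaqObsN_congr (fun e he => hUV e (Finset.mem_coe.2 (Finset.mem_union_left _ he))),
    plaqObsN_congr (p := partner i) (fun e he => hUV e (Finset.mem_coe.2 (Finset.mem_union_right _ he)))]

/-- The size of the term: `|τ κ^{n+1} obs_p obs_q| ≤ |τ| κ^{n+1}` (`0 ≤ κ`). -/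
theorem abs_axialTerm_le (hN : 1 ≤ N) (hκ : 0 ≤ κ) (i : AxialIdx d)
    (U : LGConfig d (Matrix.specialUnitaryGroup (Fin N) ℂ)) :
    |axialTerm N τ κ i U| ≤ |τ| * κ ^ (i.2.2 + 1) := by
  unfold axialTerm
  rw [abs_mul, abs_mul, abs_pow, abs_of_nonneg hκ, abs_mul]
  have h1 := abs_plaqObsN_le_one hN i.1 U
  have h2 := abs_plaqObsN_le_one hN (partner i) U
  have h12 : |plaqObsN N i.1 U| * |plaqObsN N (partner i) U| ≤ 1 := by
    calc _ ≤ 1 * 1 := mul_le_mul h1 h2 (abs_nonneg _) zero_le_one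
      _ = 1 := one_mul 1
  exact mul_le_of_le_one_right (by positivity) h12

/-- At `U ≡ 1` the term equals its coupling `τ κ^{n+1}`. -/
theorem axialTerm_one (hN : 1 ≤ N) (i : AxialIdx d) :
    axialTerm N τ κ i (1 : LGConfig d (Matrix.specialUnitaryGroup (Fin N) ℂ)) = τ * κ ^ (i.2.2 + 1) := by
  unfold axialTerm
  rw [plaqObsN_one hN, plaqObsN_one hN, mul_one, mul_one]

/-- **Oscillation witnesses**: the term oscillates by at most `2|τ|κ^{n+1}` in every link (it is bounded
by `|τ|κ^{n+1}`). -/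
theorem isOscBound_axialTerm (hN : 1 ≤ N) (hκ : 0 ≤ κ) (i : AxialIdx d) :
    Dobrushin.IsOscBound (axialTerm (d := d) N τ κ i) fun _ => 2 * (|τ| * κ ^ (i.2.2 + 1)) := by
  refine ⟨fun y => by positivity, fun y U V _ => ?_⟩
  calc |axialTerm N τ κ i U - axialTerm N τ κ i V| ≤ |axialTerm N τ κ i U| + |axialTerm N τ κ i V| :=
        abs_sub _ _
    _ ≤ |τ| * κ ^ (i.2.2 + 1) + |τ| * κ ^ (i.2.2 + 1) :=
        add_le_add (abs_axialTerm_le hN hκ i U) (abs_axialTerm_le hN hκ i V)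
    _ = 2 * (|τ| * κ ^ (i.2.2 + 1)) := by ring

/-- **Lipschitz witnesses**: the term is `|τ|κ^{n+1}/√N · (𝟙[y ∈ p] + 𝟙[y ∈ partner])`-Lipschitz in
the link `y` (one factor moves, the other is bounded by `1`). -/
theorem isLipBound_axialTerm (hN : 1 ≤ N) (hκ : 0 ≤ κ) (i : AxialIdx d) :
    IsLipBound suFrobDist (axialTerm (d := d) N τ κ i) fun y =>
      |τ| * κ ^ (i.2.2 + 1) / Real.sqrt N *
        ((if y ∈ plaquetteEdges i.1 then (1 : ℝ) else 0) + (if y ∈ plaquetteEdges (partner i) then (1 : ℝ) else 0)) := by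
  have hN0 : (0 : ℝ) < N := by exact_mod_cast hN
  have hsN : 0 < Real.sqrt N := Real.sqrt_pos.2 hN0
  refine ⟨fun y => mul_nonneg (by positivity) (add_nonneg (by split_ifs <;> norm_num) (by split_ifs <;> norm_num)),
    fun y U V hUV => ?_⟩
  set a := plaqObsN N i.1 U with ha
  set a' := plaqObsN N i.1 V with ha'
  set b := plaqObsN N (partner i) U with hb
  set b' := plaqObsN N (partner i) V with hb'
  set D := suFrobDist (U y) (V y) with hD
  have hD0 : 0 ≤ D := suFrobDist_nonneg _ _
  have hb1 : |b| ≤ 1 := abs_plaqObsN_le_one hN _ U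
  have ha'1 : |a'| ≤ 1 := abs_plaqObsN_le_one hN _ V
  have hpa : |a - a'| ≤ (if y ∈ plaquetteEdges i.1 then 1 / Real.sqrt N else 0) * D :=
    abs_plaqObsN_sub_le hN i.1 hUV
  have hpb : |b - b'| ≤ (if y ∈ plaquetteEdges (partner i) then 1 / Real.sqrt N else 0) * D :=
    abs_plaqObsN_sub_le hN (partner i) hUV
  have hsplit : a * b - a' * b' = (a - a') * b + a' * (b - b') := by ring
  have hprod : |a * b - a' * b'| ≤ (if y ∈ plaquetteEdges i.1 then 1 / Real.sqrt N else 0) * D +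
      (if y ∈ plaquetteEdges (partner i) then 1 / Real.sqrt N else 0) * D := by
    rw [hsplit]
    refine (abs_add_le _ _).trans (add_le_add ?_ ?_)
    · rw [abs_mul]
      calc |a - a'| * |b| ≤ (if y ∈ plaquetteEdges i.1 then 1 / Real.sqrt N else 0) * D * 1 :=
            mul_le_mul hpa hb1 (abs_nonneg _) (mul_nonneg (by split_ifs <;> positivity) hD0)
        _ = _ := mul_one _
    · rw [abs_mul]
      calc |a'| * |b - b'| ≤ 1 * ((if y ∈ plaquetteEdges (partner i) then 1 / Real.sqrt N else 0) * D) :=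
            mul_le_mul ha'1 hpb (abs_nonneg _) zero_le_one
        _ = _ := one_mul _
  unfold axialTerm
  rw [← ha, ← ha', ← hb, ← hb', ← mul_sub, abs_mul, abs_mul, abs_pow, abs_of_nonneg hκ]
  calc |τ| * κ ^ (i.2.2 + 1) * |a * b - a' * b'|
      ≤ |τ| * κ ^ (i.2.2 + 1) * ((if y ∈ plaquetteEdges i.1 then 1 / Real.sqrt N else 0) * D +
          (if y ∈ plaquetteEdges (partner i) then 1 / Real.sqrt N else 0) * D) :=
        mul_le_mul_of_nonneg_left hprod (by positivity)
    _ = |τ| * κ ^ (i.2.2 + 1) / Real.sqrt N *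
          ((if y ∈ plaquetteEdges i.1 then (1 : ℝ) else 0) +
            (if y ∈ plaquetteEdges (partner i) then (1 : ℝ) else 0)) * D := by
        split_ifs <;> field_simp <;> ring

end Term

end Summit.Ventures.YMGap.RobustBall
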